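import Mathlib
import Summits.NavierStokesRegularity.NavierStokesRegularity.Theorems.LerayQuarterDissipationFiniteDissipationLiouvilleWindowBlobProduction
import Summits.NavierStokesRegularity.NavierStokesRegularity.Theorems.PoloidalWindowDoorPoloidalWindowRigidityVorticityTranslate
import Literature.Analysis.FluidPDE.BarkerPrange2020VorticityAlignmentTypeIHolds
import Literature.Analysis.FluidPDE.NSLocalLerayBackwardUniqueness
import HarnessLib

/-!
# Crux `FiniteDissipationLiouville` (stmt-NavierStokesRegularity-22144): THE VORTICITY-GRADIENT FLOOR — the vorticity
# of the hypothetical singular profile is nowhere locally uniform: `(−t)^{3/2}‖∇ω‖` exceeds a definite floor somewhere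
# in EVERY parabolic ball of the core at EVERY instant, and on a whole parabolic cylinder in every window

Theorems file of route `LerayQuarterDissipation` (lead prover g20; `--supports` the crux; companion of the g20 files
`…CaloricDefect(Windows)`). Navier–Stokes regularity is NOT proved by anything here; no summit is.

A ONE-SLICE kill of the tree (cell ns-regularity-ideate, `…PoloidalWindowRigidityVorticityTranslate.
eq_zero_of_curl_translate_eq_slice`: a member of the KNSS-gauge Type-I class one of whose vorticity slices is
invariant under the translations along a line vanishes identically) is socket-mounted on the crux:

* `fderiv_curl_eq_zero_of_window`, **`eq_zero_of_fderiv_curl_window`** — if at ONE instant `s < 0` the vorticity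
  gradient `D(curl W s)` vanishes on a nonempty open set, it vanishes on `ℝ³` (real-analyticity of the slice,
  Literature `IsTypeIAncientMild.analyticOnNhd_slice_univ`), the vorticity slice is constant, hence translation
  invariant, and `W ≡ 0`; `not_singular_of_fderiv_curl_window`;
* **`fderivCurl_floor_unit`, `fderivCurl_floor_every_instant` (+ `_envelope`) — THE EVERY-INSTANT DENSE FLOOR**:
  for all `C, K, ρ, r > 0` there is `δ > 0` such that for every SINGULAR member of `𝒟_{C,K}`, every instant `t < 0`
  and every centre `‖x₀‖ ≤ ρ√(−t)`, the ball `B(x₀, r√(−t))` contains a point with `(−t)^{3/2}‖D(curl W t)(x)‖ > δ`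
  (direct compactness at `t = −1`: KNSS limits across members `Compactness.seqLimit`, pointwise convergence of the
  vorticity gradients `tendsto_fderiv_curl_of_unif`, persistence of the singularity `persistent_singularity_seq`;
  then parabolic rescaling, `fderiv_curl_nsRescale`);
* `fderivCurl_ball`, **`fderivCurl_blob_in_every_window` (+ `_envelope`)** — g19's blob socket at `θ₀ = 0`: a whole
  parabolic cylinder of relative size `ρ'` with `(−t)^{3/2}‖∇ω‖ > δ'` inside every window `[−c², −εc²]`.

Portrait clause of the registered stub `stub_envelopeCriticalLiouville` (skeleton `Lines/birth.lean`): the vorticity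
of the hypothetical finite-dissipation Type-I singularity is NOWHERE LOCALLY HOMOGENEOUS IN SPACE, AT ANY INSTANT —
its gradient has the full self-similar size `δ(−t)^{-3/2}` somewhere in every parabolic ball of the core, uniformly
over the class. (Compare the direction-oscillation floors of lead g8, which see `∇(ω/‖ω‖)` on the large-vorticity set
modulo sign, and the caloric defect of `…CaloricDefectWindows`, which sees `(W·∇)ω − (ω·∇)W`.) Instrument row: a
candidate (R)DSS profile whose vorticity gradient vanishes on an open set of one slice is not a counterexample.

HONEST FRAMING. A compactness corollary (ineffective `δ, ε, ρ'`) of a kill that was already in the tree, about a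
HYPOTHETICAL object; nothing is removed from the DSS wall (`∀ c>1 TypeIDSSLiouville c`, NECESSARY for the crux by
`…Hardness`); the verdict of the line is unchanged (FRONTIER). Nothing here bears on Navier–Stokes regularity.

References: Koch–Nadirashvili–Seregin–Šverák, Acta Math. 203 (2009) §4; P. G. Lemarié-Rieusset (2016), Thm 9.12; folklore.
-/

noncomputable section

set_option linter.dupNamespace false

namespace Summit.NavierStokesRegularity.NavierStokesRegularity.Theorems.FiniteDissipationLiouville.VorticityGradient

open MeasureTheory Set Filter Topology Metric InnerProductSpace Function Real
open scoped RealInnerProductSpace ContDiff ENNReal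
open Literature.Analysis Literature.Analysis.FluidPDE
open Summit.NavierStokesRegularity.NavierStokesRegularity.Theorems
open Summit.NavierStokesRegularity.NavierStokesRegularity.Theorems.RecurrentReductionD
open Summit.NavierStokesRegularity.NavierStokesRegularity.Theorems.FiniteDissipationLiouville
open Summit.NavierStokesRegularity.NavierStokesRegularity.Theorems.FiniteDissipationLiouville.CrossFlow
open Summit.NavierStokesRegularity.NavierStokesRegularity.Theorems.FiniteDissipationLiouville.EndpointScheme
open Summit.NavierStokesRegularity.NavierStokesRegularity.Theorems.FiniteDissipationLiouville.WindowSocket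
open Summit.NavierStokesRegularity.NavierStokesRegularity.Theorems.FiniteDissipationLiouville.WindowRecurrence
open Summit.NavierStokesRegularity.NavierStokesRegularity.Theorems.FiniteDissipationLiouville.Compactness
open Summit.NavierStokesRegularity.NavierStokesRegularity.Theorems.PoloidalWindowDoorPoloidalWindowRigidityVorticityTranslate

variable {C : ℝ} {W : ℝ → EuclideanSpace ℝ (Fin 3) → EuclideanSpace ℝ (Fin 3)}

/-! ### The one-slice kill: a locally constant vorticity slice forces `W ≡ 0` -/

section Kill

/-- The vorticity gradient of a slice of a member of the class is real-analytic on `ℝ³`.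
[cite: LemarieRieusset2016, Thm. 9.12 (PDF p. 260)] -/
theorem analyticOnNhd_fderiv_curl_slice (hW : IsTypeIAncientMild C W) {s : ℝ} (hs : s < 0) :
    AnalyticOnNhd ℝ (fderiv ℝ (curl (W s))) univ :=
  (Literature.Analysis.FluidPDE.analyticOnNhd_curl (hW.analyticOnNhd_slice_univ hs)).fderiv

/-- **Window → slice**: if the vorticity gradient of one slice vanishes on a nonempty open set, it vanishes on `ℝ³`.
[cite: LemarieRieusset2016, Thm. 9.12 (PDF p. 260)] -/
theorem fderiv_curl_eq_zero_of_window (hW : IsTypeIAncientMild C W) {s : ℝ} (hs : s < 0)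
    {U : Set (EuclideanSpace ℝ (Fin 3))} (hU : IsOpen U) (hne : U.Nonempty)
    (h : ∀ y ∈ U, fderiv ℝ (curl (W s)) y = 0) : ∀ y, fderiv ℝ (curl (W s)) y = 0 := by
  obtain ⟨y₀, hy₀⟩ := hne
  have hev : fderiv ℝ (curl (W s)) =ᶠ[𝓝 y₀] 0 :=
    Filter.eventually_of_mem (hU.mem_nhds hy₀) fun y hy => by rw [Pi.zero_apply, h y hy]
  intro y
  have := (analyticOnNhd_fderiv_curl_slice hW hs).eqOn_zero_of_preconnected_of_eventuallyEq_zero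
    isPreconnected_univ (mem_univ y₀) hev (mem_univ y)
  simpa using this

/-- A slice with vanishing vorticity gradient has translation-invariant vorticity (along every line). [folklore] -/
theorem curl_translate_eq_of_fderiv_curl_eq_zero (hW : IsTypeIAncientMild C W) {s : ℝ} (hs : s < 0)
    (h : ∀ y, fderiv ℝ (curl (W s)) y = 0) (e : EuclideanSpace ℝ (Fin 3)) :
    ∀ (y : EuclideanSpace ℝ (Fin 3)) (l : ℝ), curl (W s) (y + l • e) = curl (W s) y := by
  have hdiff : Differentiable ℝ (curl (W s)) := fun y =>
    (Literature.Analysis.FluidPDE.analyticOnNhd_curl (hW.analyticOnNhd_slice_univ hs) y (mem_univ y)).differentiableAt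
  intro y l
  exact is_const_of_fderiv_eq_zero hdiff h _ _

/-- **THE KILL (imported by name): a member of the class whose vorticity gradient vanishes on a nonempty open set of
ONE slice is identically zero** (the vorticity slice is constant, hence translation invariant; tree
`…VorticityTranslate.eq_zero_of_curl_translate_eq_slice`). [cite: KochNadirashviliSereginSverak2009, §4 (arXiv:0709.3599 p. 8)] -/
theorem eq_zero_of_fderiv_curl_window (hW : IsTypeIAncientMild C W) {s : ℝ} (hs : s < 0)
    {U : Set (EuclideanSpace ℝ (Fin 3))} (hU : IsOpen U) (hne : U.Nonempty)
    (h : ∀ y ∈ U, fderiv ℝ (curl (W s)) y = 0) : ∀ t < 0, ∀ x, W t x = 0 := by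
  have he : (EuclideanSpace.single 0 1 : EuclideanSpace ℝ (Fin 3)) ≠ 0 := fun h0 => by
    simpa using congrArg (fun w : EuclideanSpace ℝ (Fin 3) => w 0) h0
  exact eq_zero_of_curl_translate_eq_slice hW.hasTypeITimeDecay hW.continuousOn_uncurry
    (fun _ _ hst ht x => hW.mild_eq_heatExtension hst ht x) (fun _ ht => hW.isDivFree ht) hs he
    (curl_translate_eq_of_fderiv_curl_eq_zero hW hs (fderiv_curl_eq_zero_of_window hW hs hU hne h) _)

/-- Apex form: such a member is not singular at the space–time origin. [cite: KochNadirashviliSereginSverak2009, §4 (arXiv:0709.3599 p. 8)] -/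
theorem not_singular_of_fderiv_curl_window (hW : IsTypeIAncientMild C W) {s : ℝ} (hs : s < 0)
    {U : Set (EuclideanSpace ℝ (Fin 3))} (hU : IsOpen U) (hne : U.Nonempty)
    (h : ∀ y ∈ U, fderiv ℝ (curl (W s)) y = 0) :
    ¬ (∀ r > 0, ∀ M : ℝ, ∃ t ∈ Ioo (-(r ^ 2)) (0 : ℝ),
      ∃ x ∈ ball (0 : EuclideanSpace ℝ (Fin 3)) r, M < ‖W t x‖) := by
  intro hsing
  obtain ⟨t, ht, x, -, hM⟩ := hsing 1 one_pos 0
  rw [eq_zero_of_fderiv_curl_window hW hs hU hne h t ht.2 x, norm_zero] at hM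
  exact lt_irrefl _ hM

/-- Final-slab form used by the blob socket: `(−t)√(−t)‖D(curl W t)(x)‖ ≤ 0` on `(−1, 0) × ℝ³` ⇒ not singular.
[cite: KochNadirashviliSereginSverak2009, §4 (arXiv:0709.3599 p. 8)] -/
theorem not_singular_of_fderivCurlBound_finalSlab (hW : IsTypeIAncientMild C W)
    (h : ∀ t : ℝ, -1 < t → t < 0 → ∀ x, (-t) * Real.sqrt (-t) * ‖fderiv ℝ (curl (W t)) x‖ ≤ 0) :
    ¬ (∀ r > 0, ∀ M : ℝ, ∃ t ∈ Ioo (-(r ^ 2)) (0 : ℝ),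
      ∃ x ∈ ball (0 : EuclideanSpace ℝ (Fin 3)) r, M < ‖W t x‖) := by
  refine not_singular_of_fderiv_curl_window hW (s := -1 / 2) (by norm_num) isOpen_univ univ_nonempty
    fun y _ => ?_
  have hle := h (-1 / 2) (by norm_num) (by norm_num) y
  have hpos : 0 < (-(-1 / 2 : ℝ)) * Real.sqrt (-(-1 / 2 : ℝ)) := by
    have : 0 < Real.sqrt (-(-1 / 2 : ℝ)) := Real.sqrt_pos.2 (by norm_num)
    positivity
  have hn : ‖fderiv ℝ (curl (W (-1 / 2))) y‖ ≤ 0 := by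
    by_contra hc
    push Not at hc
    have := mul_pos hpos hc
    linarith
  exact norm_le_zero_iff.1 hn

end Kill

/-! ### Scale covariance -/

section Scaling

/-- `(−s)√(−s)‖D(curl V_c(s))(y)‖ = (−c²s)√(−c²s)‖D(curl V(c²s))(cy)‖` for `c > 0`: the size `(−t)^{3/2}‖∇ω‖` is
dimensionless. [folklore] -/
theorem weight_mul_norm_fderiv_curl_nsRescale (V : ℝ → EuclideanSpace ℝ (Fin 3) → EuclideanSpace ℝ (Fin 3))
    {c : ℝ} (hc : 0 < c) (s : ℝ) (y : EuclideanSpace ℝ (Fin 3)) :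
    (-s) * Real.sqrt (-s) * ‖fderiv ℝ (curl (nsRescale c V s)) y‖ =
      (-(c ^ 2 * s)) * Real.sqrt (-(c ^ 2 * s)) * ‖fderiv ℝ (curl (V (c ^ 2 * s))) (c • y)‖ := by
  rw [fderiv_curl_nsRescale, norm_smul, Real.norm_of_nonneg (by positivity : (0 : ℝ) ≤ c * c * c),
    show -(c ^ 2 * s) = c ^ 2 * (-s) by ring, Real.sqrt_mul (sq_nonneg c), Real.sqrt_sq hc.le]
  ring

/-- Scale covariance of the bound `(−s)√(−s)‖D(curl V s)(y)‖ ≤ θ`. [folklore] -/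
theorem fderivCurlBound_at_nsRescale (V : ℝ → EuclideanSpace ℝ (Fin 3) → EuclideanSpace ℝ (Fin 3)) (θ : ℝ)
    {c s : ℝ} (y : EuclideanSpace ℝ (Fin 3)) (hc : 0 < c)
    (h : (-(c ^ 2 * s)) * Real.sqrt (-(c ^ 2 * s)) * ‖fderiv ℝ (curl (V (c ^ 2 * s))) (c • y)‖ ≤ θ) :
    (-s) * Real.sqrt (-s) * ‖fderiv ℝ (curl (nsRescale c V s)) y‖ ≤ θ := by
  rwa [weight_mul_norm_fderiv_curl_nsRescale V hc s y]

end Scaling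

/-! ### The every-instant dense floor -/

section Dense

/-- **THE DENSE FLOOR AT THE UNIT SLICE (crux frame).** For all `C, K, ρ, r > 0` there is `δ > 0` such that for
every singular member `V` of `𝒟_{C,K}` and every centre `‖x₀‖ ≤ ρ` the ball `B(x₀, r)` contains a point with
`‖D(curl V(−1))(x)‖ > δ`. [one-slice kill + slice analyticity + KNSS compactness;
cite: KochNadirashviliSereginSverak2009, §4 (arXiv:0709.3599 p. 8)] -/
theorem fderivCurl_floor_unit (C K : ℝ) {ρ r : ℝ} (hr : 0 < r) :
    ∃ δ : ℝ, 0 < δ ∧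
    ∀ (V : ℝ → EuclideanSpace ℝ (Fin 3) → EuclideanSpace ℝ (Fin 3)), IsTypeIAncientMild C V →
      (∀ s : ℝ, s < 0 → ∫⁻ x, ‖fderiv ℝ (V s) x‖ₑ ^ 2 ≤ ENNReal.ofReal (K / Real.sqrt (-s))) →
      (∀ r > 0, ∀ M : ℝ, ∃ t ∈ Ioo (-(r ^ 2)) (0 : ℝ),
        ∃ x ∈ ball (0 : EuclideanSpace ℝ (Fin 3)) r, M < ‖V t x‖) →
      ∀ x₀ : EuclideanSpace ℝ (Fin 3), ‖x₀‖ ≤ ρ →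
        ∃ x ∈ ball x₀ r, δ < ‖fderiv ℝ (curl (V (-1))) x‖ := by
  by_contra hcon
  push Not at hcon
  have hbad : ∀ j : ℕ, ∃ (V : ℝ → EuclideanSpace ℝ (Fin 3) → EuclideanSpace ℝ (Fin 3))
      (x₀ : EuclideanSpace ℝ (Fin 3)), IsTypeIAncientMild C V ∧
      (∀ s : ℝ, s < 0 → ∫⁻ x, ‖fderiv ℝ (V s) x‖ₑ ^ 2 ≤ ENNReal.ofReal (K / Real.sqrt (-s))) ∧
      (∀ r > 0, ∀ M : ℝ, ∃ t ∈ Ioo (-(r ^ 2)) (0 : ℝ),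
        ∃ x ∈ ball (0 : EuclideanSpace ℝ (Fin 3)) r, M < ‖V t x‖) ∧ ‖x₀‖ ≤ ρ ∧
      ∀ x ∈ ball x₀ r, ‖fderiv ℝ (curl (V (-1))) x‖ ≤ 1 / ((j : ℝ) + 1) := by
    intro j
    obtain ⟨V, hV, hlaw, hsing, x₀, hx₀, hno⟩ := hcon (1 / ((j : ℝ) + 1)) (by positivity)
    exact ⟨V, x₀, hV, hlaw, hsing, hx₀, hno⟩
  choose V x₀ hV hlaw hsing hx₀ hsmall using hbad
  obtain ⟨xinf, -, φ, hφ, hxlim⟩ := (isCompact_closedBall (0 : EuclideanSpace ℝ (Fin 3)) ρ).tendsto_subseq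
    (fun j => mem_closedBall_zero_iff.2 (hx₀ j))
  obtain ⟨ψ, hψ, W, hW, hunif, -, -⟩ := Compactness.seqLimit (w := fun j => V (φ j)) (fun j => hV _)
  have hψt : Tendsto ψ atTop atTop := hψ.tendsto_atTop
  have hWsing := Compactness.persistent_singularity_seq (w := fun j => V (φ (ψ j)))
    (fun j => hV _) (fun j => hlaw _) (fun j => hsing _) hW hunif
  -- ## the vorticity gradient of the limit vanishes on `B(x∞, r)` at `t = −1`
  have hzero : ∀ x ∈ ball xinf r, fderiv ℝ (curl (W (-1))) x = 0 := by
    intro x hx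
    have h4 : Tendsto (fun j => fderiv ℝ (curl (V (φ (ψ j)) (-1))) x) atTop (𝓝 (fderiv ℝ (curl (W (-1))) x)) :=
      tendsto_fderiv_curl_of_unif (v := fun j => V (φ (ψ j))) (fun j => hV _) hW hunif (by norm_num) x
    have hxlim' : Tendsto (fun j => x₀ (φ (ψ j))) atTop (𝓝 xinf) := hxlim.comp hψt
    have hxr : dist x xinf < r := mem_ball.1 hx
    have hxev : ∀ᶠ j in atTop, x ∈ ball (x₀ (φ (ψ j))) r := by
      have hd : ∀ᶠ j in atTop, dist (x₀ (φ (ψ j))) xinf < r - dist x xinf :=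
        Metric.tendsto_nhds.1 hxlim' _ (by linarith)
      filter_upwards [hd] with j hj
      rw [mem_ball]
      calc dist x (x₀ (φ (ψ j))) ≤ dist x xinf + dist xinf (x₀ (φ (ψ j))) := dist_triangle _ _ _
        _ = dist x xinf + dist (x₀ (φ (ψ j))) xinf := by rw [dist_comm xinf]
        _ < r := by linarith
    have hφψ : Tendsto (fun j => φ (ψ j)) atTop atTop := hφ.tendsto_atTop.comp hψt
    have hεj : Tendsto (fun j => 1 / (((φ (ψ j) : ℕ) : ℝ) + 1)) atTop (𝓝 0) :=
      tendsto_one_div_add_atTop_nhds_zero_nat.comp hφψ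
    have hle : ‖fderiv ℝ (curl (W (-1))) x‖ ≤ 0 :=
      le_of_tendsto_of_tendsto h4.norm hεj (hxev.mono fun j hj => hsmall (φ (ψ j)) x hj)
    exact norm_le_zero_iff.1 hle
  have hW0 := eq_zero_of_fderiv_curl_window hW (s := -1) (by norm_num) isOpen_ball ⟨xinf, mem_ball_self hr⟩ hzero
  obtain ⟨t, ht, x, -, hM⟩ := hWsing 1 one_pos 0
  rw [hW0 t ht.2 x, norm_zero] at hM
  exact lt_irrefl _ hM

/-- **THE DENSE FLOOR AT EVERY INSTANT (crux frame).** For all `C, K, ρ, r > 0` there is `δ > 0` such that for every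
singular member `V` of `𝒟_{C,K}`, every `t < 0` and every centre `‖x₀‖ ≤ ρ√(−t)`, the ball `B(x₀, r√(−t))` contains
a point with `(−t)√(−t)‖D(curl V t)(x)‖ > δ`. [cite: KochNadirashviliSereginSverak2009, §4 (arXiv:0709.3599 p. 8)] -/
theorem fderivCurl_floor_every_instant (C K : ℝ) {ρ r : ℝ} (hr : 0 < r) :
    ∃ δ : ℝ, 0 < δ ∧
    ∀ (V : ℝ → EuclideanSpace ℝ (Fin 3) → EuclideanSpace ℝ (Fin 3)), IsTypeIAncientMild C V →
      (∀ s : ℝ, s < 0 → ∫⁻ x, ‖fderiv ℝ (V s) x‖ₑ ^ 2 ≤ ENNReal.ofReal (K / Real.sqrt (-s))) →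
      (∀ r > 0, ∀ M : ℝ, ∃ t ∈ Ioo (-(r ^ 2)) (0 : ℝ),
        ∃ x ∈ ball (0 : EuclideanSpace ℝ (Fin 3)) r, M < ‖V t x‖) →
      ∀ t : ℝ, t < 0 → ∀ x₀ : EuclideanSpace ℝ (Fin 3), ‖x₀‖ ≤ ρ * Real.sqrt (-t) →
        ∃ x ∈ ball x₀ (r * Real.sqrt (-t)), δ < (-t) * Real.sqrt (-t) * ‖fderiv ℝ (curl (V t)) x‖ := by
  obtain ⟨δ, hδ, h⟩ := fderivCurl_floor_unit C K (ρ := ρ) hr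
  refine ⟨δ, hδ, fun V hV hlaw hsing t ht x₀ hx₀ => ?_⟩
  set c : ℝ := Real.sqrt (-t) with hcdef
  have hc : 0 < c := Real.sqrt_pos.2 (neg_pos.2 ht)
  have hc2 : c ^ 2 * (-1) = t := by rw [hcdef, Real.sq_sqrt (neg_pos.2 ht).le]; ring
  have hx₀' : ‖c⁻¹ • x₀‖ ≤ ρ := by
    rw [norm_smul, norm_inv, Real.norm_of_nonneg hc.le, inv_mul_le_iff₀ hc, mul_comm]
    exact hx₀
  obtain ⟨x, hx, hδx⟩ := h (nsRescale c V) (hV.nsRescale hc) (dissipationLaw_nsRescale hlaw hc)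
    (singularAtOrigin_nsRescale hsing hc) (c⁻¹ • x₀) hx₀'
  refine ⟨c • x, ?_, ?_⟩
  · rw [mem_ball, dist_eq_norm] at hx ⊢
    have e : c • x - x₀ = c • (x - c⁻¹ • x₀) := by
      rw [smul_sub, smul_smul, mul_inv_cancel₀ hc.ne', one_smul]
    rw [e, norm_smul, Real.norm_of_nonneg hc.le]
    calc c * ‖x - c⁻¹ • x₀‖ < c * r := mul_lt_mul_of_pos_left hx hc
      _ = r * c := mul_comm _ _
  · have key := weight_mul_norm_fderiv_curl_nsRescale V hc (-1) x
    rw [hc2] at key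
    have h1 : (-(-1 : ℝ)) * Real.sqrt (-(-1 : ℝ)) = 1 := by norm_num
    rw [h1, one_mul] at key
    rwa [key] at hδx

/-- **THE DENSE FLOOR AT EVERY INSTANT ON THE ENVELOPED CLASS (law-free).**
[cite: KochNadirashviliSereginSverak2009, §4 (arXiv:0709.3599 p. 8)] -/
theorem fderivCurl_floor_every_instant_envelope (A : ℝ) {ρ r : ℝ} (hr : 0 < r) :
    ∃ δ : ℝ, 0 < δ ∧
    ∀ (C : ℝ) (V : ℝ → EuclideanSpace ℝ (Fin 3) → EuclideanSpace ℝ (Fin 3)), IsTypeIAncientMild C V → C ≤ A →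
      HasTypeIDecay A V →
      (∀ r > 0, ∀ M : ℝ, ∃ t ∈ Ioo (-(r ^ 2)) (0 : ℝ),
        ∃ x ∈ ball (0 : EuclideanSpace ℝ (Fin 3)) r, M < ‖V t x‖) →
      ∀ t : ℝ, t < 0 → ∀ x₀ : EuclideanSpace ℝ (Fin 3), ‖x₀‖ ≤ ρ * Real.sqrt (-t) →
        ∃ x ∈ ball x₀ (r * Real.sqrt (-t)), δ < (-t) * Real.sqrt (-t) * ‖fderiv ℝ (curl (V t)) x‖ := by
  obtain ⟨K, hK⟩ := LambProduct.exists_uniform_law_of_envelope A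
  obtain ⟨δ, hδ, h⟩ := fderivCurl_floor_every_instant A K (ρ := ρ) hr
  exact ⟨δ, hδ, fun C V hV hCA hdec hsing => h V (isTypeIAncientMild_of_le hV hCA)
    (hK (isTypeIAncientMild_of_le hV hCA) hdec) hsing⟩

end Dense

/-! ### A whole cylinder of definite relative size in every window -/

section Blob

/-- **Ball transfer for the vorticity-gradient bound with thresholds `θ_j → 0`.**
[cite: KochNadirashviliSereginSverak2009, Prop. 4.1 (arXiv:0709.3599 p. 8)] -/
theorem fderivCurl_ball {v : ℕ → ℝ → EuclideanSpace ℝ (Fin 3) → EuclideanSpace ℝ (Fin 3)}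
    {W : ℝ → EuclideanSpace ℝ (Fin 3) → EuclideanSpace ℝ (Fin 3)} {θ : ℕ → ℝ}
    (hv : ∀ j, IsTypeIAncientMild C (v j)) (hW : IsTypeIAncientMild C W)
    (hunif : ∀ n : ℕ, TendstoUniformlyOn (fun j z => v j z.1 z.2) (fun z => W z.1 z.2) atTop
      (Icc (-((n : ℝ) + 2)) (-(1 / ((n : ℝ) + 2))) ×ˢ
        closedBall (0 : EuclideanSpace ℝ (Fin 3)) ((n : ℝ) + 2)))
    (hunifG : ∀ n : ℕ, TendstoUniformlyOn (fun j z => fderiv ℝ (v j z.1) z.2) (fun z => fderiv ℝ (W z.1) z.2)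
      atTop (Icc (-((n : ℝ) + 2)) (-(1 / ((n : ℝ) + 2))) ×ˢ
        closedBall (0 : EuclideanSpace ℝ (Fin 3)) ((n : ℝ) + 2)))
    (hunifH : ∀ n : ℕ, TendstoUniformlyOn (fun j z => fderiv ℝ (fderiv ℝ (v j z.1)) z.2)
      (fun z => fderiv ℝ (fderiv ℝ (W z.1)) z.2)
      atTop (Icc (-((n : ℝ) + 2)) (-(1 / ((n : ℝ) + 2))) ×ˢ
        closedBall (0 : EuclideanSpace ℝ (Fin 3)) ((n : ℝ) + 2)))
    (hθ : Tendsto θ atTop (𝓝 0)) {t₀ : ℝ} (ht₀ : t₀ < 0) (x₀ : EuclideanSpace ℝ (Fin 3))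
    (hbad : ¬ (-t₀) * Real.sqrt (-t₀) * ‖fderiv ℝ (curl (W t₀)) x₀‖ ≤ 0) :
    ∃ r : ℝ, 0 < r ∧ ∀ᶠ j in atTop, ∀ q : ℝ × EuclideanSpace ℝ (Fin 3), dist q (t₀, x₀) < r →
      ¬ (-q.1) * Real.sqrt (-q.1) * ‖fderiv ℝ (curl (v j q.1)) q.2‖ ≤ θ j := by
  obtain ⟨s, hs, hT, -, -, -, -, h4⟩ := jet_tendsto_prod hv hW hunif hunifG hunifH ht₀ x₀
  have hR : Tendsto (fun q : ℕ × (ℝ × EuclideanSpace ℝ (Fin 3)) =>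
      (-q.2.1) * Real.sqrt (-q.2.1) * ‖fderiv ℝ (curl (v q.1 q.2.1)) q.2.2‖) (atTop ×ˢ 𝓝[s] (t₀, x₀))
      (𝓝 ((-t₀) * Real.sqrt (-t₀) * ‖fderiv ℝ (curl (W t₀)) x₀‖)) :=
    (hT.neg.mul (Real.continuous_sqrt.continuousAt.tendsto.comp hT.neg)).mul h4.norm
  have hθ' : Tendsto (fun q : ℕ × (ℝ × EuclideanSpace ℝ (Fin 3)) => θ q.1) (atTop ×ˢ 𝓝[s] (t₀, x₀)) (𝓝 0) :=
    hθ.comp tendsto_fst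
  rw [not_le] at hbad
  have hev := hθ'.eventually_lt hR hbad
  obtain ⟨r, hr, hball⟩ := exists_ball_eventually_of_prod_nhds hs hev
  exact ⟨r, hr, hball.mono fun j hj q hq => not_le.2 (hj q hq)⟩

/-- **THE VORTICITY-GRADIENT FLOOR FILLS A PARABOLIC CYLINDER IN EVERY WINDOW (crux frame).** For all `C, K` there are
`ε ∈ (0,1)`, `ρ > 0`, `δ > 0` such that every singular member of `𝒟_{C,K}` contains, in every window `[−c², −εc²]`,
a cylinder `[t₀ − (ρc)², t₀] × B(x₀, ρc)` on which `(−t)√(−t)‖D(curl V t)(x)‖ > δ`.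
[cite: KochNadirashviliSereginSverak2009, §4 (arXiv:0709.3599 p. 8)] -/
theorem fderivCurl_blob_in_every_window (C K : ℝ) : ∃ ε : ℝ, 0 < ε ∧ ε < 1 ∧ ∃ ρ : ℝ, 0 < ρ ∧
    ∃ δ : ℝ, 0 < δ ∧
    ∀ (V : ℝ → EuclideanSpace ℝ (Fin 3) → EuclideanSpace ℝ (Fin 3)), IsTypeIAncientMild C V →
      (∀ s : ℝ, s < 0 → ∫⁻ x, ‖fderiv ℝ (V s) x‖ₑ ^ 2 ≤ ENNReal.ofReal (K / Real.sqrt (-s))) →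
      (∀ r > 0, ∀ M : ℝ, ∃ t ∈ Ioo (-(r ^ 2)) (0 : ℝ),
        ∃ x ∈ ball (0 : EuclideanSpace ℝ (Fin 3)) r, M < ‖V t x‖) →
      ∀ c : ℝ, 0 < c → ∃ (t₀ : ℝ) (x₀ : EuclideanSpace ℝ (Fin 3)),
        Icc (t₀ - (ρ * c) ^ 2) t₀ ⊆ Icc (-c ^ 2) (-(ε * c ^ 2)) ∧
        ∀ t ∈ Icc (t₀ - (ρ * c) ^ 2) t₀, ∀ x ∈ ball x₀ (ρ * c),
          δ < (-t) * Real.sqrt (-t) * ‖fderiv ℝ (curl (V t)) x‖ := by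
  obtain ⟨ε, hε, hε1, ρ, hρ, δ, hδ, h⟩ := exists_blob_margin_of_apex_kill (C := C) (K := K) (θ₀ := 0)
    (Q := fun _ => True)
    (G := fun θ F s y => (-s) * Real.sqrt (-s) * ‖fderiv ℝ (curl (F s)) y‖ ≤ θ)
    (fun _ _ _ _ _ _ => trivial)
    (fun u W θ hu hW hunif hunifG hunifH hθ t₀ ht₀ x₀ hbad =>
      fderivCurl_ball hu hW hunif hunifG hunifH hθ ht₀ x₀ hbad)
    (fun W hW _ _ hG => not_singular_of_fderivCurlBound_finalSlab hW hG)
  refine ⟨ε, hε, hε1, ρ, hρ, δ, hδ, fun V hV hlaw hsing c hc => ?_⟩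
  obtain ⟨t₀, x₀, hwin, hblob⟩ := h (nsRescale c V) (hV.nsRescale hc) (dissipationLaw_nsRescale hlaw hc)
    trivial (singularAtOrigin_nsRescale hsing hc)
  obtain ⟨hwin', hblob'⟩ := blob_rescale (θ := 0 + δ) (ε := ε) (ρ := ρ) (c := c)
    (G := fun θ F s y => (-s) * Real.sqrt (-s) * ‖fderiv ℝ (curl (F s)) y‖ ≤ θ)
    (fun F c' s y hc' _ hG => fderivCurlBound_at_nsRescale F (0 + δ) y hc' hG) hc hε hwin hblob
  refine ⟨c ^ 2 * t₀, c • x₀, hwin', fun t ht x hx => ?_⟩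
  have := not_le.1 (hblob' t ht x hx)
  linarith

/-- **THE SAME ON THE ENVELOPED CLASS (law-free).** [cite: KochNadirashviliSereginSverak2009, §4 (arXiv:0709.3599 p. 8)] -/
theorem fderivCurl_blob_in_every_window_envelope (A : ℝ) : ∃ ε : ℝ, 0 < ε ∧ ε < 1 ∧ ∃ ρ : ℝ, 0 < ρ ∧
    ∃ δ : ℝ, 0 < δ ∧
    ∀ (C : ℝ) (V : ℝ → EuclideanSpace ℝ (Fin 3) → EuclideanSpace ℝ (Fin 3)),
      IsTypeIAncientMild C V → C ≤ A → HasTypeIDecay A V →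
      (∀ r > 0, ∀ M : ℝ, ∃ t ∈ Ioo (-(r ^ 2)) (0 : ℝ),
        ∃ x ∈ ball (0 : EuclideanSpace ℝ (Fin 3)) r, M < ‖V t x‖) →
      ∀ c : ℝ, 0 < c → ∃ (t₀ : ℝ) (x₀ : EuclideanSpace ℝ (Fin 3)),
        Icc (t₀ - (ρ * c) ^ 2) t₀ ⊆ Icc (-c ^ 2) (-(ε * c ^ 2)) ∧
        ∀ t ∈ Icc (t₀ - (ρ * c) ^ 2) t₀, ∀ x ∈ ball x₀ (ρ * c),
          δ < (-t) * Real.sqrt (-t) * ‖fderiv ℝ (curl (V t)) x‖ := by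
  obtain ⟨ε, hε, hε1, ρ, hρ, δ, hδ, h⟩ := exists_blob_margin_of_apex_kill_envelope (C := A) (θ₀ := 0)
    (G := fun θ F s y => (-s) * Real.sqrt (-s) * ‖fderiv ℝ (curl (F s)) y‖ ≤ θ)
    (fun u W θ hu hW hunif hunifG hunifH hθ t₀ ht₀ x₀ hbad =>
      fderivCurl_ball hu hW hunif hunifG hunifH hθ ht₀ x₀ hbad)
    (fun W hW _ hG => not_singular_of_fderivCurlBound_finalSlab hW hG)
  refine ⟨ε, hε, hε1, ρ, hρ, δ, hδ, fun C V hV hCA hdec hsing c hc => ?_⟩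
  obtain ⟨t₀, x₀, hwin, hblob⟩ := h (nsRescale c V) ((isTypeIAncientMild_of_le hV hCA).nsRescale hc)
    (hdec.nsRescale hc) (singularAtOrigin_nsRescale hsing hc)
  obtain ⟨hwin', hblob'⟩ := blob_rescale (θ := 0 + δ) (ε := ε) (ρ := ρ) (c := c)
    (G := fun θ F s y => (-s) * Real.sqrt (-s) * ‖fderiv ℝ (curl (F s)) y‖ ≤ θ)
    (fun F c' s y hc' _ hG => fderivCurlBound_at_nsRescale F (0 + δ) y hc' hG) hc hε hwin hblob
  refine ⟨c ^ 2 * t₀, c • x₀, hwin', fun t ht x hx => ?_⟩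
  have := not_le.1 (hblob' t ht x hx)
  linarith

end Blob

end Summit.NavierStokesRegularity.NavierStokesRegularity.Theorems.FiniteDissipationLiouville.VorticityGradient

end
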